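import Mathlib
import Literature.NumberTheory.Sieve.LinearPairKloostermanBox
import HarnessLib

/-!
# Exponential sums over pairs of moduli of a pair of linear congruences in the balanced divisor
# window: the Duke–Friedlander–Iwaniec bound

Topic `Literature/NumberTheory/Sieve` (conclusion of `LinearPairKloostermanPiece.lean`,
`LinearPairKloostermanBox.lean`).  Let `q₀, q₁ ≥ 1`, `a₀, a₁` with `gcd(qᵢ, aᵢ) = 1`,
`Δ = q₁a₀ − q₀a₁ ≠ 0`, `D = |Δ|`, `ν(d₀,d₁)` a solution of `d₀ ∣ q₀ν + a₀`, `d₁ ∣ q₁ν + a₁` whenever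
the pair is solvable, complex weights `|vᵢ| ≤ Gᵢ` with `v₁` supported on squarefree numbers, an
integer `k ≠ 0` and a real `|y| ≤ x`.  For the BALANCED WINDOW
`x^{1−η} < d₀d₁ ≤ x^{1+θ}`, `min(d₀, d₁) > x^σ` we prove (`norm_windowSum_le`), for every `ε > 0`,

  `‖Σ_{d₀ ≤ X₀, d₁ ≤ X₁} [solvable][window] v₀(d₀) v₁(d₁) e(k(y − ν)/lcm(d₀,d₁))‖
      ≤ K G₀ G₁ |k|^{11/8} x^{η + 7(1+θ)/8 + (1+θ−σ)(11/48+ε)} (log x)^3`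

(`K = K(q, a, ε)`; `x ≥ 6`, `0 < θ ≤ σ`, `θ ≤ 1`, `0 < η ≤ 1`, `2D ≤ x^σ`, `|a₀| ≤ x`,
`x^{1+θ−σ} ≤ Xᵢ`): dyadic boxes (those not meeting the window contribute nothing), separation of the
product condition (`norm_windowBoxSum_le`) and the box bound of Duke–Friedlander–Iwaniec
(`norm_boxSum_le`, from the tree's theorem
`DukeFriedlanderIwaniec1997_bilinearKloostermanFractions_holds`).  At `θ = η = ε = 0` the exponent
is `53/48 − 11σ/48 < 1` exactly when `σ > 5/11`: this is the Duke–Friedlander–Iwaniec range of the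
binary divisor problem for a pair of linear forms.  Everything here is PROVED.

## References

* W. Duke, J. Friedlander, H. Iwaniec, *Bilinear forms with Kloosterman fractions*, Invent. Math.
  128 (1997), 23–43; *Representations by the determinant and mean values of L-functions*, LMS
  Lecture Note Ser. 237 (1997), 109–115. [folklore]
-/

open Finset Real

namespace Literature.NumberTheory.Sieve.LinearPairKloosterman

open Literature.NumberTheory.LFunctions

/-! ### Dyadic decomposition and supports -/

/-- Dyadic decomposition of `(1, 2^J]`. [folklore] -/
theorem sum_Ioc_one_pow_two {E : Type*} [AddCommMonoid E] (f : ℕ → E) (J : ℕ) :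
    ∑ d ∈ Ioc 1 (2 ^ J), f d = ∑ j ∈ Finset.range J, ∑ d ∈ Ioc (2 ^ j) (2 * 2 ^ j), f d := by
  induction J with
  | zero => simp
  | succ J ih =>
    rw [Finset.sum_range_succ, ← ih, ← pow_succ', Finset.sum_Ioc_consecutive]
    · exact Nat.one_le_two_pow
    · exact Nat.pow_le_pow_right (by norm_num) (Nat.le_succ J)

/-- Two sums agree when the summand vanishes outside a common subset. [folklore] -/
theorem sum_eq_sum_of_support {E : Type*} [AddCommMonoid E] {T s₁ s₂ : Finset ℕ} (h₁ : T ⊆ s₁)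
    (h₂ : T ⊆ s₂) {f : ℕ → E} (hf : ∀ d, d ∉ T → f d = 0) :
    ∑ d ∈ s₁, f d = ∑ d ∈ s₂, f d := by
  rw [← Finset.sum_subset h₁ fun d _ hd => hf d hd, ← Finset.sum_subset h₂ fun d _ hd => hf d hd]

/-! ### The five factors of the box bound in the window, uniformly in the box -/

section Factors

variable {x : ℕ} {σ θ η : ℝ}

/-- `log(6x^{1+θ}) + log(6x^{1−η}) ≤ 6 log x` for `x ≥ 6`, `θ ≤ 1`, `0 ≤ η ≤ 1`. [folklore] -/
theorem log_factor_le (hx : 6 ≤ x) (hθ1 : θ ≤ 1) (hη0 : 0 ≤ η) :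
    Real.log (6 * (x : ℝ) ^ (1 + θ)) + Real.log (6 * (x : ℝ) ^ (1 - η)) ≤ 6 * Real.log x := by
  have hx6 : (6 : ℝ) ≤ x := by exact_mod_cast hx
  have hx0 : (0 : ℝ) < x := by linarith
  have hL : Real.log 6 ≤ Real.log x := Real.log_le_log (by norm_num) hx6
  have hL0 : 0 ≤ Real.log x := Real.log_nonneg (by linarith)
  rw [Real.log_mul (by norm_num) (by positivity), Real.log_mul (by norm_num) (by positivity),
    Real.log_rpow hx0, Real.log_rpow hx0]
  nlinarith

/-- `√A G₀ · √(2C) G₁ ≤ G₀ G₁ √2 x^{(1+θ)/2}` when `AC ≤ x^{1+θ}`. [folklore] -/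
theorem sqrt_factor_le (hx : 1 ≤ x) {A C : ℕ} {G₀ G₁ : ℝ} (hG₀ : 0 ≤ G₀) (hG₁ : 0 ≤ G₁)
    (hwin₂ : (A : ℝ) * C ≤ (x : ℝ) ^ (1 + θ)) :
    Real.sqrt A * G₀ * (Real.sqrt (2 * C) * G₁) ≤ G₀ * G₁ * Real.sqrt 2 * (x : ℝ) ^ ((1 + θ) / 2) := by
  have hx0 : (0 : ℝ) ≤ x := by positivity
  have hs : Real.sqrt ((x : ℝ) ^ (1 + θ)) = (x : ℝ) ^ ((1 + θ) / 2) := by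
    rw [Real.sqrt_eq_rpow, ← Real.rpow_mul hx0]
    congr 1; ring
  have h1 : Real.sqrt A * Real.sqrt (2 * C) ≤ Real.sqrt 2 * (x : ℝ) ^ ((1 + θ) / 2) := by
    calc Real.sqrt A * Real.sqrt (2 * C) = Real.sqrt 2 * Real.sqrt ((A : ℝ) * C) := by
          rw [← Real.sqrt_mul (Nat.cast_nonneg A), ← Real.sqrt_mul (by norm_num : (0 : ℝ) ≤ 2)]
          congr 1; ring
      _ ≤ Real.sqrt 2 * Real.sqrt ((x : ℝ) ^ (1 + θ)) :=
          mul_le_mul_of_nonneg_left (Real.sqrt_le_sqrt hwin₂) (Real.sqrt_nonneg _)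
      _ = Real.sqrt 2 * (x : ℝ) ^ ((1 + θ) / 2) := by rw [hs]
  calc Real.sqrt A * G₀ * (Real.sqrt (2 * C) * G₁)
      = G₀ * G₁ * (Real.sqrt A * Real.sqrt (2 * C)) := by ring
    _ ≤ G₀ * G₁ * (Real.sqrt 2 * (x : ℝ) ^ ((1 + θ) / 2)) :=
        mul_le_mul_of_nonneg_left h1 (mul_nonneg hG₀ hG₁)
    _ = _ := by ring

/-- `1 + |k|(|y| + |a₀|)D/(AC) ≤ 9 D |k| x^η` when `x^{1−η} < 4AC`, `|y|, |a₀| ≤ x`, `|k|, D ≥ 1`.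
[folklore] -/
theorem X_factor_le (hx : 1 ≤ x) (hη0 : 0 ≤ η) {A C : ℕ} {kR D yy aa : ℝ} (hk : 1 ≤ kR)
    (hD : 1 ≤ D) (hy : yy ≤ x) (ha : aa ≤ x)
    (hA0 : (0 : ℝ) < A) (hC0 : (0 : ℝ) < C) (hwin₁ : (x : ℝ) ^ (1 - η) < 4 * (A : ℝ) * C) :
    1 + kR * (yy + aa) * D / ((A : ℝ) * C) ≤ 9 * D * kR * (x : ℝ) ^ η := by
  have hx1 : (1 : ℝ) ≤ x := by exact_mod_cast hx
  have hx0 : (0 : ℝ) < x := by linarith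
  have hAC : (x : ℝ) ^ (1 - η) / 4 < (A : ℝ) * C := by linarith
  have hACpos : (0 : ℝ) < (A : ℝ) * C := by positivity
  have hxη1 : (1 : ℝ) ≤ (x : ℝ) ^ η := Real.one_le_rpow hx1 hη0
  have h3 : (x : ℝ) = (x : ℝ) ^ η * (x : ℝ) ^ (1 - η) := by
    rw [← Real.rpow_add hx0, show η + (1 - η) = (1 : ℝ) by ring, Real.rpow_one]
  have h1 : kR * (yy + aa) * D / ((A : ℝ) * C) ≤ 8 * D * kR * (x : ℝ) ^ η := by
    rw [div_le_iff₀ hACpos]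
    have h2 : yy + aa ≤ 2 * x := by linarith
    have hk0 : 0 ≤ kR := by linarith
    have hD0 : 0 ≤ D := by linarith
    calc kR * (yy + aa) * D ≤ kR * (2 * x) * D := by gcongr
      _ = 8 * D * kR * (x : ℝ) ^ η * ((x : ℝ) ^ (1 - η) / 4) := by
          conv_lhs => rw [h3]
          ring
      _ ≤ 8 * D * kR * (x : ℝ) ^ η * ((A : ℝ) * C) :=
          mul_le_mul_of_nonneg_left hAC.le (by positivity)
  have h4 : (1 : ℝ) ≤ D * kR * (x : ℝ) ^ η := by
    calc (1 : ℝ) = 1 * 1 * 1 := by ring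
      _ ≤ D * kR * (x : ℝ) ^ η := by gcongr
  linarith

/-- `(|k|D + QAC)^{3/8} ≤ (2QD)^{3/8} |k|^{3/8} x^{3(1+θ)/8}` when `AC ≤ x^{1+θ}`, `|k|, D, Q ≥ 1`.
[folklore] -/
theorem k_factor_le (hx : 1 ≤ x) (hθ0 : 0 ≤ θ) {A C : ℕ} {kR D Q : ℝ} (hk : 1 ≤ kR) (hD : 1 ≤ D)
    (hQ : 1 ≤ Q) (hwin₂ : (A : ℝ) * C ≤ (x : ℝ) ^ (1 + θ)) :
    (kR * D + Q * A * C) ^ (3 / 8 : ℝ) ≤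
      (2 * Q * D) ^ (3 / 8 : ℝ) * kR ^ (3 / 8 : ℝ) * (x : ℝ) ^ ((1 + θ) * (3 / 8)) := by
  have hx1 : (1 : ℝ) ≤ x := by exact_mod_cast hx
  have hx0 : (0 : ℝ) ≤ x := by linarith
  have hX1 : (1 : ℝ) ≤ (x : ℝ) ^ (1 + θ) := Real.one_le_rpow hx1 (by linarith)
  have hk0 : 0 ≤ kR := by linarith
  have hD0 : 0 ≤ D := by linarith
  have hQ0 : 0 ≤ Q := by linarith
  have hAC0 : 0 ≤ (A : ℝ) * C := by positivity
  have h1 : kR * D + Q * A * C ≤ (2 * Q * D) * kR * (x : ℝ) ^ (1 + θ) := by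
    have t1 : kR * D ≤ Q * D * kR * (x : ℝ) ^ (1 + θ) := by
      calc kR * D = 1 * D * kR * 1 := by ring
        _ ≤ Q * D * kR * (x : ℝ) ^ (1 + θ) := by gcongr
    have t2 : Q * A * C ≤ Q * D * kR * (x : ℝ) ^ (1 + θ) := by
      calc Q * A * C = Q * 1 * 1 * ((A : ℝ) * C) := by ring
        _ ≤ Q * D * kR * (x : ℝ) ^ (1 + θ) := by gcongr
    linarith
  calc (kR * D + Q * A * C) ^ (3 / 8 : ℝ)
      ≤ ((2 * Q * D) * kR * (x : ℝ) ^ (1 + θ)) ^ (3 / 8 : ℝ) :=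
        Real.rpow_le_rpow (by positivity) h1 (by norm_num)
    _ = _ := by
        rw [Real.mul_rpow (by positivity) (by positivity), Real.mul_rpow (by positivity)
          (by positivity), ← Real.rpow_mul hx0]

/-- `(Q(A + C))^{p} ≤ (4Q)^{p} x^{(1+θ−σ)p}` when `AC < x^{1+θ}`, `x^σ < 2A`, `x^σ < 2C`, `p ≥ 0`.
[folklore] -/
theorem MN_factor_le (hx : 1 ≤ x) {A C : ℕ} {Q p : ℝ} (hQ : 0 ≤ Q) (hp : 0 ≤ p)
    (hA0 : (0 : ℝ) < A) (hC0 : (0 : ℝ) < C)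
    (hwin₂ : (A : ℝ) * C < (x : ℝ) ^ (1 + θ)) (hminA : (x : ℝ) ^ σ < 2 * (A : ℝ))
    (hminC : (x : ℝ) ^ σ < 2 * (C : ℝ)) :
    (Q * ((A : ℝ) + C)) ^ p ≤ (4 * Q) ^ p * (x : ℝ) ^ ((1 + θ - σ) * p) := by
  have hx1 : (1 : ℝ) ≤ x := by exact_mod_cast hx
  have hx0 : (0 : ℝ) < x := by linarith
  have hxσ0 : (0 : ℝ) < (x : ℝ) ^ σ := Real.rpow_pos_of_pos hx0 σ
  have hq : (x : ℝ) ^ (1 + θ - σ) = (x : ℝ) ^ (1 + θ) / (x : ℝ) ^ σ := Real.rpow_sub hx0 _ _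
  have hA2 : (A : ℝ) ≤ 2 * (x : ℝ) ^ (1 + θ - σ) := by
    rw [hq, mul_div_assoc', le_div_iff₀ hxσ0]
    have h1 : (A : ℝ) * (x : ℝ) ^ σ ≤ (A : ℝ) * (2 * C) := mul_le_mul_of_nonneg_left hminC.le hA0.le
    nlinarith
  have hC2 : (C : ℝ) ≤ 2 * (x : ℝ) ^ (1 + θ - σ) := by
    rw [hq, mul_div_assoc', le_div_iff₀ hxσ0]
    have h1 : (C : ℝ) * (x : ℝ) ^ σ ≤ (C : ℝ) * (2 * A) := mul_le_mul_of_nonneg_left hminA.le hC0.le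
    nlinarith
  have h1 : Q * ((A : ℝ) + C) ≤ (4 * Q) * (x : ℝ) ^ (1 + θ - σ) := by nlinarith
  calc (Q * ((A : ℝ) + C)) ^ p ≤ ((4 * Q) * (x : ℝ) ^ (1 + θ - σ)) ^ p :=
        Real.rpow_le_rpow (by positivity) h1 hp
    _ = _ := by rw [Real.mul_rpow (by positivity) (by positivity), ← Real.rpow_mul hx0.le]

/-- A product inequality with five nonnegative factors and a common nonnegative prefactor.
[folklore] -/
theorem mul5_le {P a b c d f A' B' C' D' F' : ℝ} (hP : 0 ≤ P) (ha : 0 ≤ a) (hb : 0 ≤ b)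
    (hc : 0 ≤ c) (hd : 0 ≤ d) (hf : 0 ≤ f) (h1 : a ≤ A') (h2 : b ≤ B') (h3 : c ≤ C')
    (h4 : d ≤ D') (h5 : f ≤ F') :
    P * (a * b * c * d * f) ≤ P * (A' * B' * C' * D' * F') := by
  refine mul_le_mul_of_nonneg_left ?_ hP
  have hA : 0 ≤ A' := ha.trans h1
  have hB : 0 ≤ B' := hb.trans h2
  have hC : 0 ≤ C' := hc.trans h3
  have hD : 0 ≤ D' := hd.trans h4
  exact mul_le_mul (mul_le_mul (mul_le_mul (mul_le_mul h1 h2 hb hA) h3 hc (mul_nonneg hA hB)) h4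
    hd (by positivity)) h5 hf (by positivity)

end Factors

section Bound

variable {q₀ qt r s : ℕ} {a₀ a₁ : ℤ}

/-- **A box meeting the window, uniformly.**  For a dyadic box `(A,2A] × (C,2C]` that meets the
window (`x^{1−η} < 4AC`, `AC < x^{1+θ}`, `x^σ < 2A`, `x^σ < 2C`), with `x ≥ 6`, `0 < θ ≤ 1`,
`0 < η ≤ 1`, `2D ≤ x^σ`, `|y| ≤ x`, `|a₀| ≤ x`, `k ≠ 0`, weights `|hᵢ| ≤ Gᵢ` (`h₁` squarefree
supported), the windowed box sum is at most
`C₀ K G₀ G₁ |k|^{11/8} x^{η + 7(1+θ)/8 + (1+θ−σ)(11/48+ε)} log x`,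
`C₀ = 6 · 9√2 · τ(D) r² D (2q₀q₁D)^{3/8} (4q₀q₁)^{11/48+ε}`. [folklore] -/
theorem norm_windowBoxSum_le_uniform (hq₀ : 0 < q₀) (hqt : 0 < qt) (hr : 0 < r)
    (hqtc : Nat.Coprime qt (r * q₀)) (hrs : r ∣ q₀ ^ s)
    (hc₀ : IsCoprime (q₀ : ℤ) a₀) (hc₁ : IsCoprime ((r * qt : ℕ) : ℤ) a₁)
    (hΔ : (((r * qt : ℕ) : ℤ) * a₀ - (q₀ : ℤ) * a₁) ≠ 0) (ν : ℕ → ℕ → ℕ)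
    (hν : ∀ d₀ d₁ : ℕ, 0 < d₀ → 0 < d₁ → Nat.Coprime d₀ q₀ → Nat.Coprime d₁ (r * qt) →
      ((Nat.gcd d₀ d₁ : ℕ) : ℤ) ∣ (((r * qt : ℕ) : ℤ) * a₀ - (q₀ : ℤ) * a₁) →
        (d₀ : ℤ) ∣ (q₀ : ℤ) * (ν d₀ d₁) + a₀ ∧ (d₁ : ℤ) ∣ ((r * qt : ℕ) : ℤ) * (ν d₀ d₁) + a₁)
    {k : ℤ} (hk : k ≠ 0) {G₀ G₁ : ℝ} (hG₀ : 0 ≤ G₀) (hG₁ : 0 ≤ G₁) (h₀ h₁ : ℕ → ℂ)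
    (hh₀ : ∀ d, ‖h₀ d‖ ≤ G₀) (hh₁ : ∀ d, ‖h₁ d‖ ≤ G₁) (hh₁s : ∀ d, h₁ d ≠ 0 → Squarefree d)
    {K ε : ℝ} (hK : 0 ≤ K) (hε : 0 ≤ ε)
    (hDFI : ∀ (M N : ℝ), 1 / 2 ≤ M → 1 / 2 ≤ N → ∀ (k : ℤ), k ≠ 0 → ∀ (X : ℝ) (α β : ℕ → ℂ),
      (∀ m : ℕ, α m ≠ 0 → M < m ∧ (m : ℝ) ≤ 2 * M) →
      (∀ n : ℕ, β n ≠ 0 → N < n ∧ (n : ℝ) ≤ 2 * N) →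
      ‖∑ m ∈ Finset.Icc 1 (Nat.floor (2 * M)), ∑ n ∈ Finset.Icc 1 (Nat.floor (2 * N)),
          if Nat.Coprime m n then
            α m * β n * Complex.exp (2 * Real.pi * Complex.I *
              ((k : ℂ) * ((((m : ZMod n)⁻¹).val : ℕ) : ℂ) / (n : ℂ) + (X : ℂ) / ((m : ℂ) * n)))
          else 0‖ ≤
        K * Real.sqrt (∑ m ∈ Finset.Icc 1 (Nat.floor (2 * M)), ‖α m‖ ^ 2) *
          Real.sqrt (∑ n ∈ Finset.Icc 1 (Nat.floor (2 * N)), ‖β n‖ ^ 2) *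
          (1 + |X| / (M * N)) * (|(k : ℝ)| + M * N) ^ (3 / 8 : ℝ) * (M + N) ^ (11 / 48 + ε))
    {σ θ η : ℝ} {x : ℕ} (hx : 6 ≤ x) (hθ : 0 < θ) (hθ1 : θ ≤ 1) (hη : 0 < η) (hη1 : η ≤ 1)
    (h2D : 2 * (((((r * qt : ℕ) : ℤ) * a₀ - (q₀ : ℤ) * a₁)).natAbs : ℝ) ≤ (x : ℝ) ^ σ) {y : ℝ} (hy : |y| ≤ x) (ha₀ : |(a₀ : ℝ)| ≤ x)
    {A C : ℕ} (hwin₁ : (x : ℝ) ^ (1 - η) < 4 * (A : ℝ) * C) (hwin₂ : (A : ℝ) * C < (x : ℝ) ^ (1 + θ))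
    (hminA : (x : ℝ) ^ σ < 2 * (A : ℝ)) (hminC : (x : ℝ) ^ σ < 2 * (C : ℝ)) :
    ‖∑ d₀ ∈ Ioc A (2 * A), ∑ d₁ ∈ Ioc C (2 * C),
        (if ((Nat.Coprime d₀ q₀ ∧ Nat.Coprime d₁ (r * qt) ∧ ((Nat.gcd d₀ d₁ : ℕ) : ℤ) ∣ (((r * qt : ℕ) : ℤ) * a₀ - (q₀ : ℤ) * a₁)) ∧
            ((x : ℝ) ^ (1 - η) < (d₀ : ℝ) * d₁ ∧ (d₀ : ℝ) * d₁ ≤ (x : ℝ) ^ (1 + θ))) then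
          h₀ d₀ * h₁ d₁ * Complex.exp (2 * π * Complex.I *
            (((k : ℝ) * ((y - (ν d₀ d₁ : ℝ)) / ((Nat.lcm d₀ d₁ : ℕ) : ℝ)) : ℝ) : ℂ))
        else 0)‖ ≤
      (6 * (9 * Real.sqrt 2) * (((((((r * qt : ℕ) : ℤ) * a₀ - (q₀ : ℤ) * a₁)).natAbs.divisors.card : ℕ) : ℝ) * (r : ℝ) ^ 2) *
          ((((r * qt : ℕ) : ℤ) * a₀ - (q₀ : ℤ) * a₁)).natAbs * (2 * ((q₀ : ℝ) * ((r * qt : ℕ) : ℝ)) * ((((r * qt : ℕ) : ℤ) * a₀ - (q₀ : ℤ) * a₁)).natAbs) ^ (3 / 8 : ℝ) *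
          (4 * ((q₀ : ℝ) * ((r * qt : ℕ) : ℝ))) ^ (11 / 48 + ε)) *
        K * G₀ * G₁ * |(k : ℝ)| ^ (11 / 8 : ℝ) *
        (x : ℝ) ^ (η + (1 + θ) * (7 / 8) + (1 + θ - σ) * (11 / 48 + ε)) * Real.log x := by
  -- sizes
  have hD : 0 < ((((r * qt : ℕ) : ℤ) * a₀ - (q₀ : ℤ) * a₁)).natAbs := Int.natAbs_pos.2 hΔ
  have hDR : (1 : ℝ) ≤ ((((r * qt : ℕ) : ℤ) * a₀ - (q₀ : ℤ) * a₁)).natAbs := by exact_mod_cast hD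
  have hx1N : 1 ≤ x := le_trans (by norm_num) hx
  have hx6 : (6 : ℝ) ≤ x := by exact_mod_cast hx
  have hx0 : (0 : ℝ) < x := by linarith
  have hx1 : (1 : ℝ) ≤ x := by linarith
  have hxσ1 : (1 : ℝ) ≤ (x : ℝ) ^ σ := by linarith
  have hA0 : (0 : ℝ) < A := by
    have : (0 : ℝ) < 2 * (A : ℝ) := lt_of_le_of_lt (by positivity) hminA
    linarith
  have hC0 : (0 : ℝ) < C := by
    have : (0 : ℝ) < 2 * (C : ℝ) := lt_of_le_of_lt (by positivity) hminC
    linarith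
  have hA : 1 ≤ A := by
    have : (0 : ℝ) < A := hA0
    exact_mod_cast this
  have hC : ((((r * qt : ℕ) : ℤ) * a₀ - (q₀ : ℤ) * a₁)).natAbs ≤ C := by
    have : ((((((r * qt : ℕ) : ℤ) * a₀ - (q₀ : ℤ) * a₁)).natAbs : ℕ) : ℝ) < C := by linarith
    exact_mod_cast this.le
  have hY' : (1 : ℝ) ≤ (x : ℝ) ^ (1 - η) := Real.one_le_rpow hx1 (by linarith)
  have hYY : (x : ℝ) ^ (1 - η) ≤ (x : ℝ) ^ (1 + θ) :=
    Real.rpow_le_rpow_of_exponent_le hx1 (by linarith)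
  have hkR : (1 : ℝ) ≤ |(k : ℝ)| := by
    rw [← Int.cast_abs]; exact_mod_cast Int.one_le_abs hk
  have hk0 : (0 : ℝ) < |(k : ℝ)| := by linarith
  have hQ1 : (1 : ℝ) ≤ (q₀ : ℝ) * ((r * qt : ℕ) : ℝ) := by
    have h1 : (1 : ℝ) ≤ q₀ := by exact_mod_cast hq₀
    have h2 : (1 : ℝ) ≤ ((r * qt : ℕ) : ℝ) := by exact_mod_cast Nat.mul_pos hr hqt
    nlinarith
  -- the separated box bound and the five factors
  have h := norm_windowBoxSum_le hq₀ hqt hr hqtc hrs hc₀ hc₁ hΔ hA hC ν hν hk y hG₀ hG₁ h₀ h₁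
    hh₀ hh₁ hh₁s hK hε hDFI hY' hYY
  refine h.trans ?_
  have hf1 := log_factor_le hx hθ1 hη.le
  have hf2 := sqrt_factor_le (θ := θ) hx1N hG₀ hG₁ hwin₂.le
  have hf3 := X_factor_le hx1N hη.le hkR hDR hy ha₀ hA0 hC0 hwin₁
  have hf4 : (|(k : ℝ)| * ((((r * qt : ℕ) : ℤ) * a₀ - (q₀ : ℤ) * a₁)).natAbs + (q₀ : ℝ) * ((r * qt : ℕ) : ℝ) * A * C) ^ (3 / 8 : ℝ) ≤
      (2 * ((q₀ : ℝ) * ((r * qt : ℕ) : ℝ)) * ((((r * qt : ℕ) : ℤ) * a₀ - (q₀ : ℤ) * a₁)).natAbs) ^ (3 / 8 : ℝ) * |(k : ℝ)| ^ (3 / 8 : ℝ) *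
        (x : ℝ) ^ ((1 + θ) * (3 / 8)) := by
    have := k_factor_le (A := A) (C := C) hx1N hθ.le hkR hDR hQ1 hwin₂.le
    rw [show (q₀ : ℝ) * ((r * qt : ℕ) : ℝ) * A * C = ((q₀ : ℝ) * ((r * qt : ℕ) : ℝ)) * A * C by ring]
    exact this
  have hf5 : ((q₀ : ℝ) * ((r * qt : ℕ) : ℝ) * ((A : ℝ) + C)) ^ (11 / 48 + ε) ≤
      (4 * ((q₀ : ℝ) * ((r * qt : ℕ) : ℝ))) ^ (11 / 48 + ε) *
        (x : ℝ) ^ ((1 + θ - σ) * (11 / 48 + ε)) :=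
    MN_factor_le hx1N (by positivity) (by linarith) hA0 hC0 hwin₂ hminA hminC
  -- nonnegativity of the factors
  have hb1 : 0 ≤ Real.log (6 * (x : ℝ) ^ (1 + θ)) + Real.log (6 * (x : ℝ) ^ (1 - η)) := by
    have h1 : 0 ≤ Real.log (6 * (x : ℝ) ^ (1 + θ)) := Real.log_nonneg (by
      have := Real.one_le_rpow hx1 (by linarith : 0 ≤ 1 + θ); linarith)
    have h2 : 0 ≤ Real.log (6 * (x : ℝ) ^ (1 - η)) := Real.log_nonneg (by linarith)
    linarith
  have hb2 : 0 ≤ Real.sqrt A * G₀ * (Real.sqrt (2 * C) * G₁) := by positivity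
  have hb3 : 0 ≤ 1 + |(k : ℝ)| * (|y| + |(a₀ : ℝ)|) * ((((r * qt : ℕ) : ℤ) * a₀ - (q₀ : ℤ) * a₁)).natAbs / ((A : ℝ) * C) := by positivity
  have hb4 : 0 ≤ (|(k : ℝ)| * ((((r * qt : ℕ) : ℤ) * a₀ - (q₀ : ℤ) * a₁)).natAbs + (q₀ : ℝ) * ((r * qt : ℕ) : ℝ) * A * C) ^ (3 / 8 : ℝ) := by
    positivity
  have hb5 : 0 ≤ ((q₀ : ℝ) * ((r * qt : ℕ) : ℝ) * ((A : ℝ) + C)) ^ (11 / 48 + ε) := by positivity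
  set τr : ℝ := (((((((r * qt : ℕ) : ℤ) * a₀ - (q₀ : ℤ) * a₁)).natAbs.divisors.card : ℕ) : ℝ) * (r : ℝ) ^ 2) with hτr
  have hτr0 : 0 ≤ τr := by rw [hτr]; positivity
  -- the algebraic identities for the target
  have hxpow : (x : ℝ) ^ ((1 + θ) / 2) * (x : ℝ) ^ η * (x : ℝ) ^ ((1 + θ) * (3 / 8)) *
      (x : ℝ) ^ ((1 + θ - σ) * (11 / 48 + ε)) =
      (x : ℝ) ^ (η + (1 + θ) * (7 / 8) + (1 + θ - σ) * (11 / 48 + ε)) := by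
    rw [← Real.rpow_add hx0, ← Real.rpow_add hx0, ← Real.rpow_add hx0]
    congr 1; ring
  have hkpow : |(k : ℝ)| * |(k : ℝ)| ^ (3 / 8 : ℝ) = |(k : ℝ)| ^ (11 / 8 : ℝ) := by
    rw [show (11 / 8 : ℝ) = 1 + 3 / 8 by norm_num, Real.rpow_add hk0, Real.rpow_one]
  calc (Real.log (6 * (x : ℝ) ^ (1 + θ)) + Real.log (6 * (x : ℝ) ^ (1 - η))) *
        (τr * (K * (Real.sqrt A * G₀) * (Real.sqrt (2 * C) * G₁) *
          (1 + |(k : ℝ)| * (|y| + |(a₀ : ℝ)|) * ((((r * qt : ℕ) : ℤ) * a₀ - (q₀ : ℤ) * a₁)).natAbs / ((A : ℝ) * C)) *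
          (|(k : ℝ)| * ((((r * qt : ℕ) : ℤ) * a₀ - (q₀ : ℤ) * a₁)).natAbs + (q₀ : ℝ) * ((r * qt : ℕ) : ℝ) * A * C) ^ (3 / 8 : ℝ) *
          ((q₀ : ℝ) * ((r * qt : ℕ) : ℝ) * ((A : ℝ) + C)) ^ (11 / 48 + ε)))
      = (τr * K) * ((Real.log (6 * (x : ℝ) ^ (1 + θ)) + Real.log (6 * (x : ℝ) ^ (1 - η))) *
          (Real.sqrt A * G₀ * (Real.sqrt (2 * C) * G₁)) *
          (1 + |(k : ℝ)| * (|y| + |(a₀ : ℝ)|) * ((((r * qt : ℕ) : ℤ) * a₀ - (q₀ : ℤ) * a₁)).natAbs / ((A : ℝ) * C)) *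
          (|(k : ℝ)| * ((((r * qt : ℕ) : ℤ) * a₀ - (q₀ : ℤ) * a₁)).natAbs + (q₀ : ℝ) * ((r * qt : ℕ) : ℝ) * A * C) ^ (3 / 8 : ℝ) *
          ((q₀ : ℝ) * ((r * qt : ℕ) : ℝ) * ((A : ℝ) + C)) ^ (11 / 48 + ε)) := by ring
    _ ≤ (τr * K) * ((6 * Real.log x) * (G₀ * G₁ * Real.sqrt 2 * (x : ℝ) ^ ((1 + θ) / 2)) *
          (9 * ((((r * qt : ℕ) : ℤ) * a₀ - (q₀ : ℤ) * a₁)).natAbs * |(k : ℝ)| * (x : ℝ) ^ η) *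
          ((2 * ((q₀ : ℝ) * ((r * qt : ℕ) : ℝ)) * ((((r * qt : ℕ) : ℤ) * a₀ - (q₀ : ℤ) * a₁)).natAbs) ^ (3 / 8 : ℝ) *
            |(k : ℝ)| ^ (3 / 8 : ℝ) * (x : ℝ) ^ ((1 + θ) * (3 / 8))) *
          ((4 * ((q₀ : ℝ) * ((r * qt : ℕ) : ℝ))) ^ (11 / 48 + ε) *
            (x : ℝ) ^ ((1 + θ - σ) * (11 / 48 + ε)))) :=
        mul5_le (mul_nonneg hτr0 hK) hb1 hb2 hb3 hb4 hb5 hf1 hf2 hf3 hf4 hf5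
    _ = (6 * (9 * Real.sqrt 2) * τr * ((((r * qt : ℕ) : ℤ) * a₀ - (q₀ : ℤ) * a₁)).natAbs *
          (2 * ((q₀ : ℝ) * ((r * qt : ℕ) : ℝ)) * ((((r * qt : ℕ) : ℤ) * a₀ - (q₀ : ℤ) * a₁)).natAbs) ^ (3 / 8 : ℝ) *
          (4 * ((q₀ : ℝ) * ((r * qt : ℕ) : ℝ))) ^ (11 / 48 + ε)) * K * G₀ * G₁ *
          (|(k : ℝ)| * |(k : ℝ)| ^ (3 / 8 : ℝ)) *
          ((x : ℝ) ^ ((1 + θ) / 2) * (x : ℝ) ^ η * (x : ℝ) ^ ((1 + θ) * (3 / 8)) *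
            (x : ℝ) ^ ((1 + θ - σ) * (11 / 48 + ε))) * Real.log x := by ring
    _ = _ := by rw [hxpow, hkpow]

/-- `J = ⌊log₂ x⌋ + 1 ≤ 3 log x` for `x ≥ 6`. [folklore] -/
theorem log_two_succ_le {x : ℕ} (hx : 6 ≤ x) : ((Nat.log 2 x + 1 : ℕ) : ℝ) ≤ 3 * Real.log x := by
  have hx6 : (6 : ℝ) ≤ x := by exact_mod_cast hx
  have hx0 : (0 : ℝ) < x := by linarith
  have hL1 : 1 ≤ Real.log x := by
    rw [Real.le_log_iff_exp_le hx0]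
    have := Real.exp_one_lt_d9; linarith
  have h1 : ((2 ^ Nat.log 2 x : ℕ) : ℝ) ≤ x := by
    exact_mod_cast Nat.pow_log_le_self 2 (by omega : x ≠ 0)
  have h2 : (Nat.log 2 x : ℝ) * Real.log 2 ≤ Real.log x := by
    rw [← Real.log_pow]
    refine Real.log_le_log (by positivity) ?_
    exact_mod_cast h1
  have hl2 := Real.log_two_gt_d9
  have h3 : (Nat.log 2 x : ℝ) ≤ 2 * Real.log x := by
    by_contra h
    push Not at h
    nlinarith
  push_cast
  linarith

/-- **The exponential sum over the balanced window (Duke–Friedlander–Iwaniec range).**  Let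
`q₀, q₁ ≥ 1`, `gcd(qᵢ, aᵢ) = 1`, `Δ = q₁a₀ − q₀a₁ ≠ 0`, `D = |Δ|`, and `ε > 0`.  There is
`K = K(q, a, ε) > 0` such that for all `σ > 0`, `0 < θ ≤ min(σ, 1)`, `0 < η ≤ 1`, `x ≥ 6` with
`|a₀| ≤ x`, `2D ≤ x^σ`, box sides `X₀, X₁ ≥ x^{1+θ−σ}`, integers `k ≠ 0`, reals `|y| ≤ x`, complex
weights `|vᵢ| ≤ Gᵢ` with `v₁` supported on squarefree numbers, and every solution map `ν` of the
pair (`d₀ ∣ q₀ν + a₀`, `d₁ ∣ q₁ν + a₁` whenever the pair is solvable),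
`‖Σ_{d₀ ≤ X₀} Σ_{d₁ ≤ X₁} [solvable][x^{1−η} < d₀d₁ ≤ x^{1+θ}][x^σ < d₀, d₁] v₀(d₀)v₁(d₁)
    e(k(y − ν(d₀,d₁))/lcm(d₀,d₁))‖ ≤ K G₀ G₁ |k|^{11/8} x^{η + 7(1+θ)/8 + (1+θ−σ)(11/48+ε)} (log x)³`.
At `θ = η = ε = 0` the exponent is `53/48 − 11σ/48`, which is `< 1` iff `σ > 5/11`. [folklore] -/
theorem norm_windowSum_le (q₀ q₁ : ℕ) (a₀ a₁ : ℤ) (hq₀ : 0 < q₀) (hq₁ : 0 < q₁)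
    (hc₀ : IsCoprime (q₀ : ℤ) a₀) (hc₁ : IsCoprime (q₁ : ℤ) a₁)
    (hΔ : (q₁ : ℤ) * a₀ - (q₀ : ℤ) * a₁ ≠ 0) {ε : ℝ} (hε : 0 < ε) :
    ∃ K : ℝ, 0 < K ∧ ∀ (σ θ η : ℝ) (x : ℕ), 0 < σ → 0 < θ → θ ≤ σ → θ ≤ 1 → 0 < η → η ≤ 1 →
      6 ≤ x → |(a₀ : ℝ)| ≤ x → 2 * ((((q₁ : ℤ) * a₀ - (q₀ : ℤ) * a₁).natAbs : ℕ) : ℝ) ≤ (x : ℝ) ^ σ →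
      ∀ (X₀ X₁ : ℕ), (x : ℝ) ^ (1 + θ - σ) ≤ X₀ → (x : ℝ) ^ (1 + θ - σ) ≤ X₁ →
      ∀ (k : ℤ), k ≠ 0 → ∀ (y : ℝ), |y| ≤ x →
      ∀ (G₀ G₁ : ℝ), 0 ≤ G₀ → 0 ≤ G₁ → ∀ (v₀ v₁ : ℕ → ℂ), (∀ d, ‖v₀ d‖ ≤ G₀) →
      (∀ d, ‖v₁ d‖ ≤ G₁) → (∀ d, v₁ d ≠ 0 → Squarefree d) →
      ∀ (ν : ℕ → ℕ → ℕ), (∀ d₀ d₁ : ℕ, 0 < d₀ → 0 < d₁ → Nat.Coprime d₀ q₀ → Nat.Coprime d₁ q₁ →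
        ((Nat.gcd d₀ d₁ : ℕ) : ℤ) ∣ (q₁ : ℤ) * a₀ - (q₀ : ℤ) * a₁ →
          (d₀ : ℤ) ∣ (q₀ : ℤ) * (ν d₀ d₁) + a₀ ∧ (d₁ : ℤ) ∣ (q₁ : ℤ) * (ν d₀ d₁) + a₁) →
      ‖∑ d₀ ∈ Icc 1 X₀, ∑ d₁ ∈ Icc 1 X₁,
          (if ((Nat.Coprime d₀ q₀ ∧ Nat.Coprime d₁ q₁ ∧
                ((Nat.gcd d₀ d₁ : ℕ) : ℤ) ∣ (q₁ : ℤ) * a₀ - (q₀ : ℤ) * a₁) ∧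
              ((x : ℝ) ^ (1 - η) < (d₀ : ℝ) * d₁ ∧ (d₀ : ℝ) * d₁ ≤ (x : ℝ) ^ (1 + θ) ∧
                (x : ℝ) ^ σ < (d₀ : ℝ) ∧ (x : ℝ) ^ σ < (d₁ : ℝ))) then
            v₀ d₀ * v₁ d₁ * Complex.exp (2 * π * Complex.I *
              (((k : ℝ) * ((y - (ν d₀ d₁ : ℝ)) / ((Nat.lcm d₀ d₁ : ℕ) : ℝ)) : ℝ) : ℂ))
          else 0)‖ ≤
        K * G₀ * G₁ * |(k : ℝ)| ^ (11 / 8 : ℝ) *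
          (x : ℝ) ^ (η + (1 + θ) * (7 / 8) + (1 + θ - σ) * (11 / 48 + ε)) * Real.log x ^ 3 := by
  classical
  obtain ⟨r, qt, hr, rfl, hqtc, hrs⟩ := LinearCongruencePair.exists_eq_mul_coprime_part q₀ q₁ hq₁
  have hqt : 0 < qt := Nat.pos_of_ne_zero fun h0 => by rw [h0, mul_zero] at hq₁; exact lt_irrefl 0 hq₁
  have hqtc' : Nat.Coprime qt (r * q₀) :=
    Nat.Coprime.mul_right (Nat.Coprime.coprime_dvd_right hrs (Nat.Coprime.pow_right _ hqtc)) hqtc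
  obtain ⟨K, hK0, hDFI⟩ := DukeFriedlanderIwaniec1997_bilinearKloostermanFractions_holds ε hε
  have hD : 0 < ((((r * qt : ℕ) : ℤ) * a₀ - (q₀ : ℤ) * a₁)).natAbs := Int.natAbs_pos.2 hΔ
  obtain ⟨C₀, hC₀⟩ : ∃ C₀ : ℝ, C₀ = 6 * (9 * Real.sqrt 2) *
      (((((((r * qt : ℕ) : ℤ) * a₀ - (q₀ : ℤ) * a₁)).natAbs.divisors.card : ℕ) : ℝ) * (r : ℝ) ^ 2) *
      ((((r * qt : ℕ) : ℤ) * a₀ - (q₀ : ℤ) * a₁)).natAbs * (2 * ((q₀ : ℝ) * ((r * qt : ℕ) : ℝ)) * ((((r * qt : ℕ) : ℤ) * a₀ - (q₀ : ℤ) * a₁)).natAbs) ^ (3 / 8 : ℝ) *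
      (4 * ((q₀ : ℝ) * ((r * qt : ℕ) : ℝ))) ^ (11 / 48 + ε) := ⟨_, rfl⟩
  have hτ : 0 < ((((r * qt : ℕ) : ℤ) * a₀ - (q₀ : ℤ) * a₁)).natAbs.divisors.card := Finset.card_pos.2 ⟨1, Nat.one_mem_divisors.2 hD.ne'⟩
  have hC₀pos : 0 < C₀ := by
    rw [hC₀]
    have : (0 : ℝ) < ((((r * qt : ℕ) : ℤ) * a₀ - (q₀ : ℤ) * a₁)).natAbs := by exact_mod_cast hD
    have : (0 : ℝ) < ((((r * qt : ℕ) : ℤ) * a₀ - (q₀ : ℤ) * a₁)).natAbs.divisors.card := by exact_mod_cast hτ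
    have : (0 : ℝ) < ((r * qt : ℕ) : ℝ) := by exact_mod_cast Nat.mul_pos hr hqt
    positivity
  refine ⟨9 * C₀ * K, by positivity, ?_⟩
  intro σ θ η x hσ hθ hθσ hθ1 hη hη1 hx ha₀ h2D X₀ X₁ hX₀ hX₁ k hk y hy G₀ G₁ hG₀ hG₁ v₀ v₁ hv₀ hv₁
    hv₁s ν hν
  have hx6 : (6 : ℝ) ≤ x := by exact_mod_cast hx
  have hx0 : (0 : ℝ) < x := by linarith
  have hx1 : (1 : ℝ) ≤ x := by linarith
  have hxσ1 : (1 : ℝ) ≤ (x : ℝ) ^ σ := Real.one_le_rpow hx1 hσ.le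
  have hxσ0 : (0 : ℝ) < (x : ℝ) ^ σ := by linarith
  -- the summand and its support
  obtain ⟨F, hF⟩ : ∃ F : ℕ → ℕ → ℂ, F = fun d₀ d₁ =>
    (if ((Nat.Coprime d₀ q₀ ∧ Nat.Coprime d₁ (r * qt) ∧ ((Nat.gcd d₀ d₁ : ℕ) : ℤ) ∣ (((r * qt : ℕ) : ℤ) * a₀ - (q₀ : ℤ) * a₁)) ∧
        ((x : ℝ) ^ (1 - η) < (d₀ : ℝ) * d₁ ∧ (d₀ : ℝ) * d₁ ≤ (x : ℝ) ^ (1 + θ) ∧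
          (x : ℝ) ^ σ < (d₀ : ℝ) ∧ (x : ℝ) ^ σ < (d₁ : ℝ))) then
      v₀ d₀ * v₁ d₁ * Complex.exp (2 * π * Complex.I *
        (((k : ℝ) * ((y - (ν d₀ d₁ : ℝ)) / ((Nat.lcm d₀ d₁ : ℕ) : ℝ)) : ℝ) : ℂ))
    else 0) := ⟨_, rfl⟩
  have hgoal : (∑ d₀ ∈ Icc 1 X₀, ∑ d₁ ∈ Icc 1 X₁,
      (if ((Nat.Coprime d₀ q₀ ∧ Nat.Coprime d₁ (r * qt) ∧
            ((Nat.gcd d₀ d₁ : ℕ) : ℤ) ∣ (((r * qt : ℕ) : ℤ) * a₀ - (q₀ : ℤ) * a₁)) ∧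
          ((x : ℝ) ^ (1 - η) < (d₀ : ℝ) * d₁ ∧ (d₀ : ℝ) * d₁ ≤ (x : ℝ) ^ (1 + θ) ∧
            (x : ℝ) ^ σ < (d₀ : ℝ) ∧ (x : ℝ) ^ σ < (d₁ : ℝ))) then
        v₀ d₀ * v₁ d₁ * Complex.exp (2 * π * Complex.I *
          (((k : ℝ) * ((y - (ν d₀ d₁ : ℝ)) / ((Nat.lcm d₀ d₁ : ℕ) : ℝ)) : ℝ) : ℂ))
      else 0)) = ∑ d₀ ∈ Icc 1 X₀, ∑ d₁ ∈ Icc 1 X₁, F d₀ d₁ := by rw [hF]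
  rw [hgoal]
  obtain ⟨T, hT⟩ : ∃ T : Finset ℕ, T = Ioc 1 ⌊(x : ℝ) ^ (1 + θ - σ)⌋₊ := ⟨_, rfl⟩
  have hmemT : ∀ d d' : ℕ, (x : ℝ) ^ σ < d → (x : ℝ) ^ σ < d' →
      (d : ℝ) * d' ≤ (x : ℝ) ^ (1 + θ) → d ∈ T := by
    intro d d' hd hd' hdd
    rw [hT, Finset.mem_Ioc]
    constructor
    · have : (1 : ℝ) < d := lt_of_le_of_lt hxσ1 hd
      exact_mod_cast this
    · refine Nat.le_floor ?_
      rw [Real.rpow_sub hx0, le_div_iff₀ hxσ0]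
      have hd0 : (0 : ℝ) ≤ d := Nat.cast_nonneg d
      nlinarith
  have hsupp : ∀ d₀ d₁, F d₀ d₁ ≠ 0 → d₀ ∈ T ∧ d₁ ∈ T := by
    intro d₀ d₁ hne
    simp only [hF] at hne
    by_cases hc : ((Nat.Coprime d₀ q₀ ∧ Nat.Coprime d₁ (r * qt) ∧ ((Nat.gcd d₀ d₁ : ℕ) : ℤ) ∣ (((r * qt : ℕ) : ℤ) * a₀ - (q₀ : ℤ) * a₁)) ∧
        ((x : ℝ) ^ (1 - η) < (d₀ : ℝ) * d₁ ∧ (d₀ : ℝ) * d₁ ≤ (x : ℝ) ^ (1 + θ) ∧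
          (x : ℝ) ^ σ < (d₀ : ℝ) ∧ (x : ℝ) ^ σ < (d₁ : ℝ)))
    · obtain ⟨-, -, h2, h3, h4⟩ := hc
      exact ⟨hmemT d₀ d₁ h3 h4 h2, hmemT d₁ d₀ h4 h3 (by rw [mul_comm]; exact h2)⟩
    · exact absurd (if_neg hc) hne
  -- the dyadic range
  obtain ⟨J, hJ⟩ : ∃ J : ℕ, J = Nat.log 2 x + 1 := ⟨_, rfl⟩
  have h2J : x < 2 ^ J := by rw [hJ]; exact Nat.lt_pow_succ_log_self (by norm_num) x
  have hθσ' : (x : ℝ) ^ (1 + θ - σ) ≤ x := by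
    calc (x : ℝ) ^ (1 + θ - σ) ≤ (x : ℝ) ^ (1 : ℝ) :=
          Real.rpow_le_rpow_of_exponent_le hx1 (by linarith)
      _ = x := Real.rpow_one _
  have hTsub : ∀ {X : ℕ}, (x : ℝ) ^ (1 + θ - σ) ≤ X → T ⊆ Icc 1 X := by
    intro X hX d hd
    rw [hT, Finset.mem_Ioc] at hd
    rw [Finset.mem_Icc]
    refine ⟨hd.1.le, ?_⟩
    have : (⌊(x : ℝ) ^ (1 + θ - σ)⌋₊ : ℝ) ≤ X := (Nat.floor_le (by positivity)).trans hX
    exact hd.2.trans (by exact_mod_cast this)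
  have hTJ : T ⊆ Ioc 1 (2 ^ J) := by
    intro d hd
    rw [hT, Finset.mem_Ioc] at hd
    rw [Finset.mem_Ioc]
    refine ⟨hd.1, hd.2.trans ?_⟩
    have : (⌊(x : ℝ) ^ (1 + θ - σ)⌋₊ : ℝ) ≤ (2 ^ J : ℕ) := by
      refine (Nat.floor_le (by positivity)).trans (hθσ'.trans ?_)
      exact_mod_cast h2J.le
    exact_mod_cast this
  -- rewrite the sum over dyadic boxes
  have hS : ∑ d₀ ∈ Icc 1 X₀, ∑ d₁ ∈ Icc 1 X₁, F d₀ d₁ =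
      ∑ j ∈ Finset.range J, ∑ l ∈ Finset.range J,
        ∑ d₀ ∈ Ioc (2 ^ j) (2 * 2 ^ j), ∑ d₁ ∈ Ioc (2 ^ l) (2 * 2 ^ l), F d₀ d₁ := by
    have h1 : ∀ d₀, ∑ d₁ ∈ Icc 1 X₁, F d₀ d₁ = ∑ d₁ ∈ Ioc 1 (2 ^ J), F d₀ d₁ := fun d₀ =>
      sum_eq_sum_of_support (hTsub hX₁) hTJ fun d₁ hd₁ => by
        by_contra h; exact hd₁ (hsupp d₀ d₁ h).2
    have h2 : ∑ d₀ ∈ Icc 1 X₀, ∑ d₁ ∈ Ioc 1 (2 ^ J), F d₀ d₁ =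
        ∑ d₀ ∈ Ioc 1 (2 ^ J), ∑ d₁ ∈ Ioc 1 (2 ^ J), F d₀ d₁ :=
      sum_eq_sum_of_support (hTsub hX₀) hTJ fun d₀ hd₀ => Finset.sum_eq_zero fun d₁ _ => by
        by_contra h; exact hd₀ (hsupp d₀ d₁ h).1
    simp_rw [h1]
    rw [h2, sum_Ioc_one_pow_two]
    refine Finset.sum_congr rfl fun j _ => ?_
    rw [Finset.sum_congr rfl fun d₀ _ => sum_Ioc_one_pow_two (fun d₁ => F d₀ d₁) J,
      Finset.sum_comm]
  -- the bound for one box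
  have hbox : ∀ j l : ℕ, ‖∑ d₀ ∈ Ioc (2 ^ j) (2 * 2 ^ j), ∑ d₁ ∈ Ioc (2 ^ l) (2 * 2 ^ l), F d₀ d₁‖ ≤
      C₀ * K * G₀ * G₁ * |(k : ℝ)| ^ (11 / 8 : ℝ) *
        (x : ℝ) ^ (η + (1 + θ) * (7 / 8) + (1 + θ - σ) * (11 / 48 + ε)) * Real.log x := by
    intro j l
    by_cases hmeet : ((x : ℝ) ^ (1 - η) < 4 * ((2 ^ j : ℕ) : ℝ) * ((2 ^ l : ℕ) : ℝ) ∧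
        ((2 ^ j : ℕ) : ℝ) * ((2 ^ l : ℕ) : ℝ) < (x : ℝ) ^ (1 + θ) ∧
        (x : ℝ) ^ σ < 2 * ((2 ^ j : ℕ) : ℝ) ∧ (x : ℝ) ^ σ < 2 * ((2 ^ l : ℕ) : ℝ))
    · -- the box meets the window: separate and apply DFI
      obtain ⟨h₀, hh₀⟩ : ∃ h₀ : ℕ → ℂ, h₀ = fun d : ℕ => if (x : ℝ) ^ σ < (d : ℝ) then v₀ d else 0 :=
        ⟨_, rfl⟩
      obtain ⟨h₁, hh₁⟩ : ∃ h₁ : ℕ → ℂ, h₁ = fun d : ℕ => if (x : ℝ) ^ σ < (d : ℝ) then v₁ d else 0 :=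
        ⟨_, rfl⟩
      have hh₀b : ∀ d, ‖h₀ d‖ ≤ G₀ := fun d => by
        simp only [hh₀]; split_ifs
        · exact hv₀ d
        · rw [norm_zero]; exact hG₀
      have hh₁b : ∀ d, ‖h₁ d‖ ≤ G₁ := fun d => by
        simp only [hh₁]; split_ifs
        · exact hv₁ d
        · rw [norm_zero]; exact hG₁
      have hh₁s : ∀ d, h₁ d ≠ 0 → Squarefree d := fun d hd => by
        simp only [hh₁] at hd
        by_cases hc : (x : ℝ) ^ σ < d
        · rw [if_pos hc] at hd; exact hv₁s d hd
        · exact absurd (if_neg hc) hd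
      have heq : ∑ d₀ ∈ Ioc (2 ^ j) (2 * 2 ^ j), ∑ d₁ ∈ Ioc (2 ^ l) (2 * 2 ^ l), F d₀ d₁ =
          ∑ d₀ ∈ Ioc (2 ^ j) (2 * 2 ^ j), ∑ d₁ ∈ Ioc (2 ^ l) (2 * 2 ^ l),
            (if ((Nat.Coprime d₀ q₀ ∧ Nat.Coprime d₁ (r * qt) ∧ ((Nat.gcd d₀ d₁ : ℕ) : ℤ) ∣ (((r * qt : ℕ) : ℤ) * a₀ - (q₀ : ℤ) * a₁)) ∧
                ((x : ℝ) ^ (1 - η) < (d₀ : ℝ) * d₁ ∧ (d₀ : ℝ) * d₁ ≤ (x : ℝ) ^ (1 + θ))) then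
              h₀ d₀ * h₁ d₁ * Complex.exp (2 * π * Complex.I *
                (((k : ℝ) * ((y - (ν d₀ d₁ : ℝ)) / ((Nat.lcm d₀ d₁ : ℕ) : ℝ)) : ℝ) : ℂ))
            else 0) := by
        refine Finset.sum_congr rfl fun d₀ _ => Finset.sum_congr rfl fun d₁ _ => ?_
        simp only [hF, hh₀, hh₁]
        by_cases hs : (Nat.Coprime d₀ q₀ ∧ Nat.Coprime d₁ (r * qt) ∧ ((Nat.gcd d₀ d₁ : ℕ) : ℤ) ∣ (((r * qt : ℕ) : ℤ) * a₀ - (q₀ : ℤ) * a₁))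
        · by_cases hw : ((x : ℝ) ^ (1 - η) < (d₀ : ℝ) * d₁ ∧ (d₀ : ℝ) * d₁ ≤ (x : ℝ) ^ (1 + θ))
          · by_cases hm₀ : (x : ℝ) ^ σ < d₀
            · by_cases hm₁ : (x : ℝ) ^ σ < d₁
              · rw [if_pos ⟨hs, hw.1, hw.2, hm₀, hm₁⟩, if_pos ⟨hs, hw⟩, if_pos hm₀, if_pos hm₁]
              · rw [if_neg (fun h => hm₁ h.2.2.2.2), if_pos ⟨hs, hw⟩, if_neg hm₁, mul_zero,
                  zero_mul]
            · rw [if_neg (fun h => hm₀ h.2.2.2.1), if_pos ⟨hs, hw⟩, if_neg hm₀, zero_mul, zero_mul]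
          · rw [if_neg (fun h => hw ⟨h.2.1, h.2.2.1⟩), if_neg (fun h => hw h.2)]
        · rw [if_neg (fun h => hs h.1), if_neg (fun h => hs h.1)]
      rw [heq]
      have hu := norm_windowBoxSum_le_uniform hq₀ hqt hr hqtc' hrs hc₀ hc₁ hΔ ν hν hk hG₀ hG₁ h₀ h₁
        hh₀b hh₁b hh₁s hK0.le hε.le hDFI hx hθ hθ1 hη hη1 h2D hy ha₀ hmeet.1 hmeet.2.1 hmeet.2.2.1
        hmeet.2.2.2
      refine hu.trans (le_of_eq ?_)
      rw [hC₀]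
    · -- the box misses the window: every term vanishes
      have hzero : ∑ d₀ ∈ Ioc (2 ^ j) (2 * 2 ^ j), ∑ d₁ ∈ Ioc (2 ^ l) (2 * 2 ^ l), F d₀ d₁ = 0 := by
        refine Finset.sum_eq_zero fun d₀ hd₀ => Finset.sum_eq_zero fun d₁ hd₁ => ?_
        simp only [hF]
        rw [if_neg]
        rintro ⟨-, h1, h2, h3, h4⟩
        rw [Finset.mem_Ioc] at hd₀ hd₁
        have e1 : ((2 ^ j : ℕ) : ℝ) < d₀ := by exact_mod_cast hd₀.1
        have e2 : (d₀ : ℝ) ≤ 2 * ((2 ^ j : ℕ) : ℝ) := by exact_mod_cast hd₀.2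
        have e3 : ((2 ^ l : ℕ) : ℝ) < d₁ := by exact_mod_cast hd₁.1
        have e4 : (d₁ : ℝ) ≤ 2 * ((2 ^ l : ℕ) : ℝ) := by exact_mod_cast hd₁.2
        have p1 : (0 : ℝ) ≤ ((2 ^ j : ℕ) : ℝ) := by positivity
        have p2 : (0 : ℝ) ≤ ((2 ^ l : ℕ) : ℝ) := by positivity
        refine hmeet ⟨?_, ?_, ?_, ?_⟩
        · calc (x : ℝ) ^ (1 - η) < (d₀ : ℝ) * d₁ := h1
            _ ≤ (2 * ((2 ^ j : ℕ) : ℝ)) * (2 * ((2 ^ l : ℕ) : ℝ)) := by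
                refine mul_le_mul e2 e4 (Nat.cast_nonneg _) (by positivity)
            _ = _ := by ring
        · exact lt_of_lt_of_le (mul_lt_mul'' e1 e3 p1 p2) h2
        · linarith
        · linarith
      rw [hzero, norm_zero]
      have : 0 ≤ Real.log x := Real.log_nonneg hx1
      positivity
  -- sum of the box bounds
  rw [hS]
  have hJ3 : (J : ℝ) ≤ 3 * Real.log x := by
    have := log_two_succ_le hx
    rw [hJ]; exact_mod_cast this
  have hL0 : 0 ≤ Real.log x := Real.log_nonneg hx1
  obtain ⟨UB, hUB⟩ : ∃ UB : ℝ, UB = C₀ * K * G₀ * G₁ * |(k : ℝ)| ^ (11 / 8 : ℝ) *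
      (x : ℝ) ^ (η + (1 + θ) * (7 / 8) + (1 + θ - σ) * (11 / 48 + ε)) * Real.log x := ⟨_, rfl⟩
  have hUB0 : 0 ≤ UB := by rw [hUB]; positivity
  rw [← hUB] at hbox
  calc ‖∑ j ∈ Finset.range J, ∑ l ∈ Finset.range J,
        ∑ d₀ ∈ Ioc (2 ^ j) (2 * 2 ^ j), ∑ d₁ ∈ Ioc (2 ^ l) (2 * 2 ^ l), F d₀ d₁‖
      ≤ ∑ j ∈ Finset.range J, ∑ l ∈ Finset.range J, UB := by
        refine (norm_sum_le _ _).trans (Finset.sum_le_sum fun j _ => ?_)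
        exact (norm_sum_le _ _).trans (Finset.sum_le_sum fun l _ => hbox j l)
    _ = (J : ℝ) ^ 2 * UB := by
        rw [Finset.sum_const, Finset.card_range, nsmul_eq_mul, Finset.sum_const,
          Finset.card_range, nsmul_eq_mul]; ring
    _ ≤ (3 * Real.log x) ^ 2 * UB := by
        refine mul_le_mul_of_nonneg_right ?_ hUB0
        exact pow_le_pow_left₀ (by positivity) hJ3 2
    _ = _ := by rw [hUB]; ring

end Bound

end Literature.NumberTheory.Sieve.LinearPairKloosterman
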